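import Mathlib.Analysis.SpecialFunctions.Pow.Real
import Mathlib.Analysis.SpecificLimits.Basic
import HarnessLib

/-!
# Barrier: raising the Sobolev order in the subcritical `H^r`-Grönwall local theory never lengthens
# the guaranteed existence horizon (the «T*(r) → ∞ as r → ∞» device lives only on the empty data class)

Barrier catalogue entry for `NavierStokesRegularity` (D-0021), METHOD LEVEL, everything PROVED (pure real
arithmetic; no named fact). Cell `ns-claims` (D-0090), technique row T1 «energy / enstrophy a-priori
estimate upgraded to a global strong bound», variant «order raising»; device row C24 `Li2013b`
(arXiv 1310.8031 v1, Proposal 5 pp. 7–8), siblings C17 `Chae2007` · C75 · C81 («subcritical Grönwall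
misread as global»). Salvage seat ns-claims-salvage-p5.

THE SCHEME. On the periodic box with lowest Stokes eigenvalue `λ₁` the `H^r` energy inequality and the
Poincaré chain give, for `y(t) = ‖u(t)‖²_r`, the differential inequality
`y′ ≤ C_r · y · y^{e_r}`, `e_r = 2r/(2r−1)`, `C_r = c(r) λ₁^{−(r−1)}`, `c(r) = (2^{r+1}c′/ν)^{(2r+1)/(2r−1)}`
[cite: LiJunDe2013NSPeriodic, eq. (36)–(37) p. 7; (39)–(41) p. 8], and the comparison principle bounds `y`
on `[0,T]` as long as `T · 2r C_r y₀^{e_r} < 2r − 1` [cite: LiJunDe2013NSPeriodic, eq. (42)–(43) p. 8], i.e.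
(this file, `li43_iff`) as long as `T < T*(r) := λ₁^{r−1}/(e_r c(r) y₀^{e_r})` — the sharp horizon of
`y′ ≤ C y^p`, `p = 1 + e_r` (tree: `Literature.Analysis.ODE.le_profile_of_deriv_le_rpow`,
`Literature.Analysis.ODE.hasDerivAt_powerLawProfile` — the majorant is attained and blows up at the
horizon, so nothing horizon-free follows from the law) [cite: RobinsonRodrigoSadowskiCUP2016, Exercise 6.2 (Ch. 6) with the proof of Thm 6.8, (6.8), §6.2 p.133–134 (comparison principle for X' ≤ cX³; general exponent p > 1 here)].
THE DEVICE (C24, p. 8 after (43)): «the T in (43) can increase without bound as r increases because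
λ₁ = 4π²» — true when `y₀ = ‖u₀‖²_r` is BOUNDED IN `r` (`Literature.Claims.NS.Li2013b.step4_horizonGrows_holds`,
kernel), which on the unit box with zero average means `u₀ = 0`
(`Summit.NavierStokesRegularity.NavierStokesRegularity.Theorems.Li2013b.dataClass38_eq_zero`, the vacuity
verdict ADJUDICATED #40).

WHAT IS PROVED HERE (the method-level negative): for ANY datum with one non-zero Fourier mode —
`‖u₀‖²_r ≥ a·λ₁^r` for all `r`, some `a > 0` (every retained eigenvalue is `≥ λ₁`) — the horizon gain
`λ₁^{r−1}` in the numerator is cancelled exactly by the unavoidable growth of `‖u₀‖²_r`, and what is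
left is killed by the scheme's own constant `c(r) ↑ ∞`:
* `li43_iff` — the printed condition (43) is `T < T*(r)`;
* `horizon_le_of_mode` — if `λ₁ ≥ 1` and `y₀ ≥ aλ₁^r ≥ 1` then `T*(r) ≤ 1/(λ₁ · a · c)` (any `c > 0`);
* `cLi_ge` — `c(r) ≥ 2^{r+1}c′/ν` once `2^{r+1}c′/ν ≥ 1`;
* `eventually_horizon_le` — for `λ₁ > 1`: `T*(r) ≤ ν/(λ₁ a c′ 2^{r+1})` for all large `r` (geometric
  decay); `eventually_horizon_lt`: `T*(r) < ε` eventually; `eventually_li43_fails`: for every `T > 0` the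
  printed condition (43) FAILS for all large `r`;
* `SobolevOrderRaisingNoHorizonGain` (structured barrier block) and `sobolevOrderRaisingNoHorizonGain_holds`.
So raising the Sobolev order shrinks — never lengthens — the guaranteed horizon of the subcritical local
theory for a fixed non-zero datum; a T-uniform bound needs an ingredient that is not in the `H^r`
ledger (an a-priori bound of a critical or subcritical quantity: `Summit.NavierStokesRegularity.StrongHypotheses.*`
on the positive side; `Literature.Barriers.NavierStokesRegularity.EnergySupercriticality` for why the
energy alone cannot supply it [cite: Tao2007WhyNSHard, supercriticality paragraph (rescaling `u^{(λ)}`)]).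

WHAT THIS IS NOT: not a claim about NS regularity or blow-up; not a claim about any author beyond the
typed locator.
-/

noncomputable section

open Filter Topology

namespace Literature.Barriers.NavierStokesRegularity

namespace SobolevOrderRaising

/-- The exponent `e_r = 2r/(2r−1)` of the `H^r`-Grönwall law `y′ ≤ C_r y^{1+e_r}` (Li's (39)–(42):
`‖u‖_r^{4r/(2r−1)} = (‖u‖_r²)^{e_r}`; same body as `Literature.Claims.NS.Li2013b.expo`).
[cite: LiJunDe2013NSPeriodic, eq. (39)–(42) p. 8] -/
def expo (r : ℕ) : ℝ :=
  (2 : ℝ) * r / (2 * r - 1)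

/-- Li's constant `c(r) = (2^{r+1}c′/ν)^{(2r+1)/(2r−1)}` ((37) p. 7; same body as
`Literature.Claims.NS.Li2013b.cConst`). [cite: LiJunDe2013NSPeriodic, eq. (37) p. 7] -/
def cLi (c' ν : ℝ) (r : ℕ) : ℝ :=
  (2 ^ (r + 1) * c' / ν) ^ (((2 : ℝ) * r + 1) / (2 * r - 1))

/-- **The guaranteed horizon of the `H^r` scheme**: `T*(r) = λ₁^{r−1}/(e_r · c · y₀^{e_r})` — the sharp
existence time delivered by `y′ ≤ (c λ₁^{−(r−1)}) y^{1+e_r}`, `y(0) = y₀` (equivalently (43):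
`T* = (2r−1)λ₁^{r−1}/(2r c y₀^{e_r})`, see `li43_iff`). [cite: LiJunDe2013NSPeriodic, eq. (43) p. 8] -/
def horizon (lam1 c : ℝ) (r : ℕ) (y₀ : ℝ) : ℝ :=
  lam1 ^ (r - 1) / (expo r * c * y₀ ^ expo r)

/-- `e_r ≥ 1` for `r ≥ 1`. [cite: LiJunDe2013NSPeriodic, eq. (39)–(42) p. 8] -/
theorem one_le_expo {r : ℕ} (hr : 1 ≤ r) : 1 ≤ expo r := by
  unfold expo
  have hr' : (1 : ℝ) ≤ r := by exact_mod_cast hr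
  rw [le_div_iff₀ (by linarith)]
  linarith

/-- `e_r > 0` for `r ≥ 1`. [cite: LiJunDe2013NSPeriodic, eq. (39)–(42) p. 8] -/
theorem expo_pos {r : ℕ} (hr : 1 ≤ r) : 0 < expo r :=
  lt_of_lt_of_le one_pos (one_le_expo hr)

/-- **(43) is the statement `T < T*(r)`**: for `r ≥ 1`, `c > 0`, `λ₁ > 0`, `y₀ > 0`,
`T · (2r · (c λ₁^{−(r−1)}) · y₀^{e_r}) < 2r − 1 ↔ T < λ₁^{r−1}/(e_r c y₀^{e_r})`.
[cite: LiJunDe2013NSPeriodic, eq. (43) p. 8] -/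
theorem li43_iff {lam1 c T y₀ : ℝ} {r : ℕ} (hr : 1 ≤ r) (hlam : 0 < lam1) (hc : 0 < c)
    (hy : 0 < y₀) :
    T * (2 * r * (c * (lam1 ^ (r - 1))⁻¹) * y₀ ^ expo r) < 2 * r - 1 ↔ T < horizon lam1 c r y₀ := by
  have hr' : (1 : ℝ) ≤ r := by exact_mod_cast hr
  have h2r1 : (0 : ℝ) < 2 * r - 1 := by linarith
  have he : 0 < expo r := expo_pos hr
  have hL : 0 < lam1 ^ (r - 1) := pow_pos hlam _
  have hY : 0 < y₀ ^ expo r := Real.rpow_pos_of_pos hy _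
  have hD : 0 < expo r * c * y₀ ^ expo r := by positivity
  have hrew : T * (2 * r * (c * (lam1 ^ (r - 1))⁻¹) * y₀ ^ expo r) =
      T * (expo r * c * y₀ ^ expo r) / lam1 ^ (r - 1) * (2 * r - 1) := by
    unfold expo
    field_simp
  rw [hrew, mul_lt_iff_lt_one_left h2r1, div_lt_one hL, horizon, lt_div_iff₀ hD]

/-- **Core estimate — the `λ₁^{r−1}` gain is cancelled by the growth of `‖u₀‖²_r`**: for `r ≥ 1`,
`λ₁ ≥ 1`, `c > 0`, `a > 0`, if `y₀ ≥ a λ₁^r ≥ 1` (one non-zero mode of squared size `a` at an eigenvalue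
`≥ λ₁`, order large enough) then `T*(r) ≤ 1/(λ₁ · a · c)`: `T* = λ₁^{r−1}/(e_r c y₀^{e_r})` with
`e_r ≥ 1` and `y₀^{e_r} ≥ y₀ ≥ aλ₁^r`. [cite: LiJunDe2013NSPeriodic, eq. (43) p. 8] -/
theorem horizon_le_of_mode {lam1 c a y₀ : ℝ} {r : ℕ} (hr : 1 ≤ r) (hlam : 1 ≤ lam1) (hc : 0 < c)
    (ha : 0 < a) (hy : a * lam1 ^ r ≤ y₀) (hbig : 1 ≤ a * lam1 ^ r) :
    horizon lam1 c r y₀ ≤ 1 / (lam1 * a * c) := by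
  have hlam0 : 0 < lam1 := lt_of_lt_of_le one_pos hlam
  have he1 : 1 ≤ expo r := one_le_expo hr
  have hy1 : 1 ≤ y₀ := hbig.trans hy
  have hy0 : 0 < y₀ := by linarith
  have hpow : a * lam1 ^ r ≤ y₀ ^ expo r := hy.trans (Real.self_le_rpow_of_one_le hy1 he1)
  have hD : 0 < expo r * c * y₀ ^ expo r := by
    have := expo_pos hr
    positivity
  have hr0 : r ≠ 0 := by omega
  unfold horizon
  rw [div_le_div_iff₀ hD (by positivity)]
  calc lam1 ^ (r - 1) * (lam1 * a * c) = 1 * c * (a * (lam1 ^ (r - 1) * lam1)) := by ring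
    _ = 1 * c * (a * lam1 ^ r) := by rw [pow_sub_one_mul hr0]
    _ ≤ expo r * c * y₀ ^ expo r := by gcongr
    _ = 1 * (expo r * c * y₀ ^ expo r) := (one_mul _).symm

/-- `(2r+1)/(2r−1) ≥ 1` for `r ≥ 1`. [cite: LiJunDe2013NSPeriodic, eq. (37) p. 7] -/
theorem one_le_cLi_exponent {r : ℕ} (hr : 1 ≤ r) : (1 : ℝ) ≤ ((2 : ℝ) * r + 1) / (2 * r - 1) := by
  have hr' : (1 : ℝ) ≤ r := by exact_mod_cast hr
  rw [le_div_iff₀ (by linarith)]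
  linarith

/-- **The scheme's own constant grows**: `c(r) ≥ 2^{r+1}c′/ν` as soon as `2^{r+1}c′/ν ≥ 1` (the exponent
`(2r+1)/(2r−1)` is `≥ 1`). [cite: LiJunDe2013NSPeriodic, eq. (37) p. 7] -/
theorem cLi_ge {c' ν : ℝ} {r : ℕ} (hr : 1 ≤ r) (hq : 1 ≤ 2 ^ (r + 1) * c' / ν) :
    2 ^ (r + 1) * c' / ν ≤ cLi c' ν r :=
  Real.self_le_rpow_of_one_le hq (one_le_cLi_exponent hr)

/-- **Geometric decay of the horizon along the order**: for `λ₁ > 1`, `c′, ν, a > 0` and squared data norms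
`y₀(r) ≥ aλ₁^r` (any non-zero datum), there is `R` with `T*(r) ≤ ν/(λ₁ a c′ 2^{r+1})` for all `r ≥ R`.
[cite: LiJunDe2013NSPeriodic, eq. (37) p. 7 and (43) p. 8] -/
theorem eventually_horizon_le {lam1 c' ν a : ℝ} (hlam : 1 < lam1) (hc' : 0 < c') (hν : 0 < ν)
    (ha : 0 < a) (y₀ : ℕ → ℝ) (hy : ∀ r : ℕ, a * lam1 ^ r ≤ y₀ r) :
    ∃ R : ℕ, ∀ r ≥ R, horizon lam1 (cLi c' ν r) r (y₀ r) ≤ ν / (lam1 * a * c' * 2 ^ (r + 1)) := by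
  -- `aλ₁^r ≥ 1` and `2^{r+1}c′/ν ≥ 1` for all large `r`
  have h1 : ∀ᶠ r : ℕ in atTop, 1 ≤ a * lam1 ^ r := by
    have ht : Tendsto (fun r : ℕ => a * lam1 ^ r) atTop atTop :=
      Tendsto.const_mul_atTop ha (tendsto_pow_atTop_atTop_of_one_lt hlam)
    exact ht.eventually_ge_atTop 1
  have h2 : ∀ᶠ r : ℕ in atTop, 1 ≤ 2 ^ (r + 1) * c' / ν := by
    have ht : Tendsto (fun r : ℕ => 2 ^ (r + 1) * c' / ν) atTop atTop := by
      have h2 : Tendsto (fun r : ℕ => (2 : ℝ) ^ (r + 1)) atTop atTop :=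
        (tendsto_pow_atTop_atTop_of_one_lt one_lt_two).comp (tendsto_add_atTop_nat 1)
      exact (h2.atTop_mul_const hc').atTop_div_const hν
    exact ht.eventually_ge_atTop 1
  obtain ⟨R, hR⟩ := eventually_atTop.1 ((h1.and h2).and (eventually_ge_atTop 1))
  refine ⟨R, fun r hr => ?_⟩
  obtain ⟨⟨hbig, hq⟩, hr1⟩ := hR r hr
  have hq0 : 0 < 2 ^ (r + 1) * c' / ν := by positivity
  have hcpos : 0 < cLi c' ν r := lt_of_lt_of_le hq0 (cLi_ge hr1 hq)
  have hlam0 : 0 < lam1 := lt_trans one_pos hlam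
  calc horizon lam1 (cLi c' ν r) r (y₀ r) ≤ 1 / (lam1 * a * cLi c' ν r) :=
        horizon_le_of_mode hr1 hlam.le hcpos ha (hy r) hbig
    _ ≤ 1 / (lam1 * a * (2 ^ (r + 1) * c' / ν)) := by
        apply one_div_le_one_div_of_le (by positivity)
        exact mul_le_mul_of_nonneg_left (cLi_ge hr1 hq) (by positivity)
    _ = ν / (lam1 * a * c' * 2 ^ (r + 1)) := by
        field_simp

/-- **The horizon tends to zero along the order**: under the same hypotheses, for every `ε > 0`,
`T*(r) < ε` for all large `r`. [cite: LiJunDe2013NSPeriodic, eq. (43) p. 8] -/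
theorem eventually_horizon_lt {lam1 c' ν a : ℝ} (hlam : 1 < lam1) (hc' : 0 < c') (hν : 0 < ν)
    (ha : 0 < a) (y₀ : ℕ → ℝ) (hy : ∀ r : ℕ, a * lam1 ^ r ≤ y₀ r) {ε : ℝ} (hε : 0 < ε) :
    ∃ R : ℕ, ∀ r ≥ R, horizon lam1 (cLi c' ν r) r (y₀ r) < ε := by
  obtain ⟨R₁, hR₁⟩ := eventually_horizon_le hlam hc' hν ha y₀ hy
  have hlam0 : 0 < lam1 := lt_trans one_pos hlam
  -- `ν/(λ₁ a c′ 2^{r+1}) < ε` for large `r`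
  have h3 : ∀ᶠ r : ℕ in atTop, ν / (lam1 * a * c' * ε) < 2 ^ (r + 1) := by
    have h2 : Tendsto (fun r : ℕ => (2 : ℝ) ^ (r + 1)) atTop atTop :=
      (tendsto_pow_atTop_atTop_of_one_lt one_lt_two).comp (tendsto_add_atTop_nat 1)
    exact h2.eventually_gt_atTop _
  obtain ⟨R₂, hR₂⟩ := eventually_atTop.1 h3
  refine ⟨max R₁ R₂, fun r hr => ?_⟩
  have hr₁ : R₁ ≤ r := le_trans (le_max_left _ _) hr
  have hr₂ : R₂ ≤ r := le_trans (le_max_right _ _) hr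
  have hK : 0 < lam1 * a * c' := by positivity
  calc horizon lam1 (cLi c' ν r) r (y₀ r) ≤ ν / (lam1 * a * c' * 2 ^ (r + 1)) := hR₁ r hr₁
    _ < ε := by
        rw [div_lt_iff₀ (by positivity)]
        have := hR₂ r hr₂
        rw [div_lt_iff₀ (by positivity)] at this
        nlinarith

/-- **The printed device fails for every non-zero datum**: for `λ₁ > 1`, `c′, ν, a > 0`, `y₀(r) ≥ aλ₁^r`,
and every `T > 0`, the condition (43) `T·2r·(c(r)λ₁^{−(r−1)})·y₀(r)^{e_r} < 2r − 1` is FALSE for all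
large `r` — raising the order does not bring any fixed positive time `T` inside the guaranteed horizon.
(Contrast: with `y₀` constant in `r` — the empty class (38) — it holds for large `r`,
`Literature.Claims.NS.Li2013b.step4_horizonGrows_holds`.) [cite: LiJunDe2013NSPeriodic, p. 8 (sentence after (43))] -/
theorem eventually_li43_fails {lam1 c' ν a : ℝ} (hlam : 1 < lam1) (hc' : 0 < c') (hν : 0 < ν)
    (ha : 0 < a) (y₀ : ℕ → ℝ) (hy : ∀ r : ℕ, a * lam1 ^ r ≤ y₀ r) {T : ℝ} (hT : 0 < T) :
    ∃ R : ℕ, ∀ r ≥ R,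
      ¬ (T * (2 * r * (cLi c' ν r * (lam1 ^ (r - 1))⁻¹) * y₀ r ^ expo r) < 2 * r - 1) := by
  obtain ⟨R₁, hR₁⟩ := eventually_horizon_lt hlam hc' hν ha y₀ hy hT
  have h2 : ∀ᶠ r : ℕ in atTop, 1 ≤ 2 ^ (r + 1) * c' / ν := by
    have ht : Tendsto (fun r : ℕ => 2 ^ (r + 1) * c' / ν) atTop atTop := by
      have h2 : Tendsto (fun r : ℕ => (2 : ℝ) ^ (r + 1)) atTop atTop :=
        (tendsto_pow_atTop_atTop_of_one_lt one_lt_two).comp (tendsto_add_atTop_nat 1)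
      exact (h2.atTop_mul_const hc').atTop_div_const hν
    exact ht.eventually_ge_atTop 1
  obtain ⟨R₂, hR₂⟩ := eventually_atTop.1 (h2.and (eventually_ge_atTop 1))
  refine ⟨max R₁ R₂, fun r hr hlt => ?_⟩
  have hr₁ : R₁ ≤ r := le_trans (le_max_left _ _) hr
  obtain ⟨hq, hr1⟩ := hR₂ r (le_trans (le_max_right _ _) hr)
  have hlam0 : 0 < lam1 := lt_trans one_pos hlam
  have hq0 : 0 < 2 ^ (r + 1) * c' / ν := by positivity
  have hcpos : 0 < cLi c' ν r := lt_of_lt_of_le hq0 (cLi_ge hr1 hq)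
  have hy0 : 0 < y₀ r := lt_of_lt_of_le (by positivity) (hy r)
  have := (li43_iff hr1 hlam0 hcpos hy0).1 hlt
  exact absurd this (not_lt.2 (hR₁ r hr₁).le)

end SobolevOrderRaising

open SobolevOrderRaising

/-- **Barrier (method-level lemma): order raising gives no horizon gain in the subcritical `H^r` scheme.**
For every `λ₁ > 1` (lowest eigenvalue of the box), `c′, ν > 0` (the constants of the `H^r` energy
inequality (36)–(37)), every `a > 0` and every sequence of squared data norms with `y₀(r) ≥ aλ₁^r` (ANY
datum with a non-zero mode: all retained eigenvalues are `≥ λ₁`), and every `T > 0`: the printed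
continuation condition (43) `T·2r C_r y₀(r)^{2r/(2r−1)} < 2r − 1` fails for all large `r`.
[cite: LiJunDe2013NSPeriodic, eq. (43) p. 8 and the sentence after it]

BARRIER (structured block, D-0021):
technique_class: energy-method subcritical-Hr-gronwall order-raising horizon-bootstrap sobolev-ladder local-theory-run-globally
blocks: regularity arguments that take the `H^r` (or `H^m`, `m` large) energy inequality `y′ ≤ c(r)λ₁^{−(r−1)} y^{1+2r/(2r−1)}` with its comparison-principle horizon `T*(r)` and conclude a bound on `[0,T]` for EVERY `T` by «choosing `r` large», i.e. by letting the Sobolev order absorb the horizon (typed device: C24 `Li2013b` p. 8 after (43), `Literature.Claims.NS.Li2013b.Step4_HorizonGrows` — TRUE only with `y₀` independent of `r`); the same ledger read through a time or solution RESCALING instead of the order is the sibling device of C17 `Chae2007` / C75 / C81 (context `Literature.Barriers.NavierStokesRegularity.EnergySupercriticality`) [cite: LiJunDe2013NSPeriodic, Proposal 5 pp. 7–8].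
because: for a non-zero datum `‖u₀‖²_r ≥ aλ₁^r` grows at least as fast as the gain `λ₁^{r−1}`, so `T*(r) ≤ 1/(λ₁ a c(r))` (`horizon_le_of_mode`), and the scheme's own constant `c(r) = (2^{r+1}c′/ν)^{(2r+1)/(2r−1)} ≥ 2^{r+1}c′/ν` diverges (`cLi_ge`): `T*(r) ≤ ν/(λ₁ a c′ 2^{r+1}) → 0` (`eventually_horizon_le`, `eventually_horizon_lt`) and (43) fails at every fixed `T > 0` for large `r` (`eventually_li43_fails`); the differential inequality itself delivers exactly the sharp local majorant and nothing beyond (`Literature.Analysis.ODE.le_profile_of_deriv_le_rpow`, `hasDerivAt_powerLawProfile`, `Literature.Analysis.ODE.superlinearProfile_unbounded`) [cite: RobinsonRodrigoSadowskiCUP2016, Exercise 6.2 (Ch. 6) with the proof of Thm 6.8, (6.8), §6.2 p.133–134 (comparison principle for X' ≤ cX³; general exponent p > 1 here)].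
evasions_known: data with `sup_r ‖u₀‖_r < ∞` — spectrum inside `{λ_k ≤ 1}`, EMPTY for zero-mean data when `λ₁ > 1` (the vacuity of C24's class (38), `…Theorems.Li2013b.dataClass38_eq_zero`) and finite-dimensional (band-limited) for long boxes; small data / large viscosity, where the subcritical ledger does close globally (`Literature.Analysis.FluidPDE.kato_global_small_holds`, `Literature.Analysis.FluidPDE.Torus.exists_global_classicalNS_of_small_enstrophy`); a genuine a-priori bound of a critical or subcritical norm on the maximal interval — which is the regularity problem (`Summit.NavierStokesRegularity.StrongHypotheses.navierStokesRegularity_of_classicalBKMBound`) [cite: Tao2007WhyNSHard, supercriticality paragraph (rescaling `u^{(λ)}`)].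
scope_caveats: (i) the kernel theorems are real arithmetic on the printed horizon formula with Li's constants `c(r)`; an `H^r` scheme with `r`-bounded constants still has `T*(r) ≤ 1/(λ₁ a e_r c)` BOUNDED in `r` by `horizon_le_of_mode` (no growth «without bound»), but the decay to `0` uses `c(r) → ∞`; (ii) `λ₁ > 1` (unit box: `λ₁ = 4π²`) is assumed in the asymptotic statements — for `λ₁ ≤ 1` the lower bound `aλ₁^r` does not dominate and the device fails through `c(r) → ∞` alone (C24 RETYPE §2 R#2, not formalised here); (iii) nothing here bears on NS regularity or blow-up — it records what the subcritical `H^r` ledger can and cannot deliver.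
status: established -/
def SobolevOrderRaisingNoHorizonGain : Prop :=
  ∀ lam1 c' ν a : ℝ, 1 < lam1 → 0 < c' → 0 < ν → 0 < a →
    ∀ y₀ : ℕ → ℝ, (∀ r : ℕ, a * lam1 ^ r ≤ y₀ r) →
      ∀ T : ℝ, 0 < T → ∃ R : ℕ, ∀ r ≥ R,
        ¬ (T * (2 * r * (cLi c' ν r * (lam1 ^ (r - 1))⁻¹) * y₀ r ^ expo r) < 2 * r - 1)

/-- Discharge of the barrier entry. [cite: LiJunDe2013NSPeriodic, eq. (43) p. 8 and the sentence after it] -/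
theorem sobolevOrderRaisingNoHorizonGain_holds : SobolevOrderRaisingNoHorizonGain :=
  fun _ _ _ _ hlam hc' hν ha y₀ hy _ hT => eventually_li43_fails hlam hc' hν ha y₀ hy hT

end Literature.Barriers.NavierStokesRegularity
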